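import Mathlib.NumberTheory.LSeries.RiemannZeta
import Mathlib.Analysis.SpecialFunctions.Gamma.Beta
import Literature.NumberTheory.LFunctions.ZetaZeros
import Literature.NumberTheory.DiophantineGeometry.NamedHypotheses
import HarnessLib

/-!
# Named numerical hypotheses: the Turing-method reduction for `RiemannHypothesisUpTo`

Companion to `Literature/NumberTheory/DiophantineGeometry/NamedHypotheses.lean`. The named fact
`Literature.NumberTheory.DiophantineGeometry.riemannHypothesisUpTo_platt_trudgian` (`RiemannHypothesisUpTo 3000175332800`;
D. Platt, T. Trudgian, *The Riemann hypothesis is true up to `3 · 10¹²`*, Bull. LMS 53 (2021),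
Theorem 1) is a 7.5-million-core-hour ball-arithmetic computation and is not discharged here.
This file proves the *analytic reduction* by which every modern verification (Turing 1953,
Lehman 1970, Brent 1979, Platt 2017, Platt–Trudgian 2021 §2) concludes, and isolates the
computational content as one named fact in count form.

## Contents (all in namespace `Literature`)

* `re_pos_of_riemannZeta_eq_zero`: a zero of `ζ` off the real axis has `0 < re s` (functional
  equation `riemannZeta_one_sub` + `riemannZeta_ne_zero_of_one_le_re`); with Mathlib's
  non-vanishing on `re s ≥ 1` this puts every zero with `im s ≠ 0` in the open critical strip
  (Titchmarsh §2.12). Real proof.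
* `mem_zetaZeroBox_of_riemannZeta_eq_zero`: a zero with `0 < im s ≤ T` lies in the counting box
  `zetaZeroBox 0 T` of `N(T)`. Real proof.
* `riemannZetaZeroOrder_pos_of_mem_zetaZeroBox`: multiplicities are positive on the box.
* `criticalZeroCount_le` : `N₀(T) ≤ N(T)` (real proof); it is, verbatim, the statement of the named
  fact `Literature.NumberTheory.LFunctions.criticalZeroCount_le_zetaZeroCount` of `ZetaZeros.lean`, which is therefore discharged
  here as `criticalZeroCount_le_zetaZeroCount_holds`.
* `RiemannHypothesisUpTo.of_zetaZeroCount_le_criticalZeroCount`: **the Turing-method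
  reduction** — if `N(T) ≤ N₀(T)` (all the zeros predicted by the zero count have been found on
  the critical line) then RH holds up to height `T`. Real proof.
* `riemannHypothesisUpTo_iff_criticalZeroCount_eq`: `RiemannHypothesisUpTo T ↔ N₀(T) = N(T)`.
* `zetaZeroCount_platt_trudgian` (named fact): the count form of Platt–Trudgian Thm. 1 / §2,
  `N(H) ≤ 12 363 153 437 138 ≤ N₀(H)` for `H = 3 000 175 332 800` (Bull. LMS 53 (2021),
  bib key `PlattTrudgianBLMS2021`).
* `riemannHypothesisUpTo_platt_trudgian_of_zeroCount`: the named hypothesis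
  `riemannHypothesisUpTo_platt_trudgian` follows from `zetaZeroCount_platt_trudgian` (real proof).

## Proof architecture of the source (Platt–Trudgian 2021, §2; Platt, Math. Comp. 86 (2017))

1. Rigorous (ball-arithmetic, windowed-FFT) evaluation of Hardy's `Z(t)` on a lattice of mesh
   `≈ 0.01` in `t ∈ (0, H]`; each sign change of `Z` is a zero of `ζ` on the critical line
   (`Literature.NumberTheory.LFunctions.hardyZ_eq_zero_iff`), whence a lower bound `n ≤ N₀(H)`.
2. Turing's method (Turing 1953; Lehman 1970; Trudgian, *Improvements to Turing's method*,
   Math. Comp. 80 (2011), Thm. 2.2): an explicit bound on `∫ S(t) dt` over a short range above `H`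
   converts a few more sign changes of `Z` found there into the upper bound `N(H) ≤ n`
   (the general theory — the Turing–Lehman inequality, `Literature.NumberTheory.LFunctions.zetaZeroCount_le_of_turing`,
   `Literature.NumberTheory.DiophantineGeometry.RiemannHypothesisUpTo.of_turing` — is proved in
   `Literature.NumberTheory.LFunctions.TuringMethod`; that `Z(t) = 0 ↔ ζ(1/2 + it) = 0` is
   `Literature.NumberTheory.LFunctions.hardyZ_eq_zero_iff_holds` in `Literature.NumberTheory.LFunctions.RiemannSiegelPhase`).
3. The reduction proved here: `N(H) ≤ n ≤ N₀(H)` forces every zero with `0 < im ρ ≤ H` onto the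
   line (and `N₀(H) = N(H) = n = 12 363 153 437 138`).

Steps 1–2 are the computation (XL; no kernel-checkable certificate exists); they are exactly the
content of the named fact `zetaZeroCount_platt_trudgian`.

## References

* D. J. Platt, T. S. Trudgian, *The Riemann hypothesis is true up to `3 · 10¹²`*, Bull. Lond.
  Math. Soc. 53 (2021), 792–797, Theorem 1 and §2 (arXiv:2004.09765).
* D. J. Platt, *Isolating some non-trivial zeros of zeta*, Math. Comp. 86 (2017), 2449–2467.
* A. M. Turing, *Some calculations of the Riemann zeta-function*, Proc. LMS (3) 3 (1953), 99–117.
* T. S. Trudgian, *Improvements to Turing's method*, Math. Comp. 80 (2011), 2259–2279,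
  Thm. 2.2.
* E. C. Titchmarsh, *The Theory of the Riemann Zeta-Function*, 2nd ed. (1986), §2.12, §9.1.
-/

noncomputable section

open Complex Set

namespace Literature.NumberTheory.DiophantineGeometry

/-! ### Zeros off the real axis lie in the open critical strip -/

/-- A zero `s` of `ζ` with `im s ≠ 0` has `0 < re s`. Proof: otherwise `u = 1 - s` has
`re u ≥ 1`, so `ζ u ≠ 0` (`riemannZeta_ne_zero_of_one_le_re`), `Γ u ≠ 0`, `cos (π u / 2) ≠ 0`
(as `im u ≠ 0`), and the functional equation `riemannZeta_one_sub` gives `ζ s ≠ 0`.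
(Titchmarsh §2.12.) [cite: Titchmarsh1986, §2.12] -/
theorem re_pos_of_riemannZeta_eq_zero {s : ℂ} (hs : riemannZeta s = 0) (him : s.im ≠ 0) :
    0 < s.re := by
  by_contra h
  rw [not_lt] at h
  set u : ℂ := 1 - s with hu
  have hure : 1 ≤ u.re := by simp only [hu, sub_re, one_re]; linarith
  have huim : u.im = -s.im := by simp [hu]
  have hu_nat : ∀ n : ℕ, u ≠ -n := by
    intro n hn
    apply him
    have := congrArg Complex.im hn
    simpa [huim] using this
  have hu1 : u ≠ 1 := by
    intro h1
    apply him
    have := congrArg Complex.im h1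
    simpa [huim] using this
  have hfe := riemannZeta_one_sub hu_nat hu1
  have h1s : 1 - u = s := by simp [hu]
  rw [h1s, hs] at hfe
  have hζ : riemannZeta u ≠ 0 := riemannZeta_ne_zero_of_one_le_re hure
  have hΓ : Gamma u ≠ 0 := Gamma_ne_zero_of_re_pos (by linarith)
  have hπ : (Real.pi : ℂ) ≠ 0 := ofReal_ne_zero.2 Real.pi_ne_zero
  have hpow : (2 * (Real.pi : ℂ)) ^ (-u) ≠ 0 := by
    rw [Ne, cpow_eq_zero_iff, not_and_or]
    exact Or.inl (mul_ne_zero two_ne_zero hπ)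
  have hcos : Complex.cos (Real.pi * u / 2) ≠ 0 := by
    intro h0
    obtain ⟨k, hk⟩ := Complex.cos_eq_zero_iff.1 h0
    have hk' : u * Real.pi = (2 * k + 1) * Real.pi := by
      rw [mul_comm u]; exact (div_left_inj' two_ne_zero).1 hk
    have huk : u = 2 * k + 1 := mul_right_cancel₀ hπ hk'
    apply him
    have := congrArg Complex.im huk
    simpa [huim] using this
  exact mul_ne_zero (mul_ne_zero (mul_ne_zero (mul_ne_zero two_ne_zero hpow) hΓ) hcos) hζ
    hfe.symm

/-- A zero `s` of `ζ` has `re s < 1` (Hadamard–de la Vallée Poussin, Mathlib's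
`riemannZeta_ne_zero_of_one_le_re`). [folklore] -/
theorem re_lt_one_of_riemannZeta_eq_zero {s : ℂ} (hs : riemannZeta s = 0) : s.re < 1 :=
  not_le.1 fun h ↦ riemannZeta_ne_zero_of_one_le_re h hs

/-- A zero `s` of `ζ` with `0 < im s ≤ T` lies in the counting box `zetaZeroBox 0 T` of `N(T)`
(so `N(T)` really counts *all* zeros with `0 < im ρ ≤ T`; Titchmarsh §9.1). [folklore] -/
theorem mem_zetaZeroBox_of_riemannZeta_eq_zero {s : ℂ} {T : ℝ} (hs : riemannZeta s = 0)
    (h0 : 0 < s.im) (hT : s.im ≤ T) : s ∈ LFunctions.zetaZeroBox 0 T :=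
  ⟨hs, (re_pos_of_riemannZeta_eq_zero hs h0.ne').le, (re_lt_one_of_riemannZeta_eq_zero hs).le,
    h0, hT⟩

/-- Multiplicities are positive on the counting boxes: `ρ ∈ zetaZeroBox σ T → 0 < m(ρ)`
(`riemannZetaZeroOrder_pos_iff`; `ρ ≠ 1` as `im ρ > 0`). [folklore] -/
theorem riemannZetaZeroOrder_pos_of_mem_zetaZeroBox {σ T : ℝ} {ρ : ℂ}
    (h : ρ ∈ LFunctions.zetaZeroBox σ T) : 0 < LFunctions.riemannZetaZeroOrder ρ := by
  obtain ⟨h0, -, -, h3, -⟩ := h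
  refine (LFunctions.riemannZetaZeroOrder_pos_iff ?_).2 h0
  rintro rfl
  simp at h3

/-! ### The critical zeros inside the box -/

/-- The set summed over by `criticalZeroCount T`: zeros on the critical line with
`0 < im ρ ≤ T`. [folklore] -/
theorem criticalZeroSet_subset_zetaZeroBox (T : ℝ) :
    {ρ ∈ LFunctions.zetaZeroBox (1 / 2) T | ρ.re = 1 / 2} ⊆ LFunctions.zetaZeroBox 0 T := by
  rintro ρ ⟨⟨h0, h1, h2, h3, h4⟩, -⟩
  exact ⟨h0, by linarith, h2, h3, h4⟩

/-- Under RH up to height `T`, the critical zeros with `0 < im ρ ≤ T` are all the zeros of the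
box `zetaZeroBox 0 T`. [folklore] -/
theorem criticalZeroSet_eq_zetaZeroBox_of_riemannHypothesisUpTo {T : ℝ}
    (h : RiemannHypothesisUpTo T) :
    {ρ ∈ LFunctions.zetaZeroBox (1 / 2) T | ρ.re = 1 / 2} = LFunctions.zetaZeroBox 0 T := by
  refine (criticalZeroSet_subset_zetaZeroBox T).antisymm ?_
  rintro ρ ⟨h0, -, h2, h3, h4⟩
  have hre : ρ.re = 1 / 2 := h ρ h0 h3 h4
  exact ⟨⟨h0, hre.ge, h2, h3, h4⟩, hre⟩

/-- `N₀(T) ≤ N(T)`, with a real proof (sub-sum of a sum of positive multiplicities). This is,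
verbatim, the statement `∀ T, N₀(T) ≤ N(T)` of the named fact
`Literature.NumberTheory.LFunctions.criticalZeroCount_le_zetaZeroCount` (`ZetaZeros.lean`), discharged below.
(Titchmarsh §9.1, §10.1.) [folklore] -/
theorem criticalZeroCount_le (T : ℝ) : LFunctions.criticalZeroCount T ≤ LFunctions.zetaZeroCount T := by
  have hA : (LFunctions.zetaZeroBox 0 T).Finite := LFunctions.zetaZeroBox_finite 0 T
  have hC : {ρ ∈ LFunctions.zetaZeroBox (1 / 2) T | ρ.re = 1 / 2}.Finite :=
    (LFunctions.zetaZeroBox_finite _ _).subset (sep_subset _ _)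
  unfold LFunctions.criticalZeroCount LFunctions.zetaZeroCount LFunctions.zetaZeroCountRe
  refine Int.toNat_le_toNat ?_
  rw [finsum_mem_eq_finite_toFinset_sum _ hA, finsum_mem_eq_finite_toFinset_sum _ hC]
  refine Finset.sum_le_sum_of_subset_of_nonneg
    ((Finite.toFinset_subset_toFinset).2 (criticalZeroSet_subset_zetaZeroBox T)) ?_
  intro ρ hρ _
  exact (riemannZetaZeroOrder_pos_of_mem_zetaZeroBox ((Finite.mem_toFinset hA).1 hρ)).le

/-- **Discharge of the named fact `Literature.NumberTheory.LFunctions.criticalZeroCount_le_zetaZeroCount`** (`ZetaZeros.lean`;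
Titchmarsh §9.1, §10.1): `N₀(T) ≤ N(T)` for every `T`. [folklore] -/
theorem criticalZeroCount_le_zetaZeroCount_holds : LFunctions.criticalZeroCount_le_zetaZeroCount :=
  criticalZeroCount_le

/-! ### The Turing-method reduction -/

/-- **Turing-method reduction.** If `N(T) ≤ N₀(T)` — the number of zeros with `0 < im ρ ≤ T`
(with multiplicity) does not exceed the number found on the critical line — then RH holds up to
height `T`. Proof: a zero `s` off the line with `0 < im s ≤ T` lies in `zetaZeroBox 0 T`
(`mem_zetaZeroBox_of_riemannZeta_eq_zero`) but not in the critical sub-box, and all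
multiplicities are positive, so `N₀(T) < N(T)`. This is the concluding step of every numerical
RH verification (Turing 1953 §4; Platt–Trudgian 2021 §2). [folklore] -/
theorem RiemannHypothesisUpTo.of_zetaZeroCount_le_criticalZeroCount {T : ℝ}
    (h : LFunctions.zetaZeroCount T ≤ LFunctions.criticalZeroCount T) : RiemannHypothesisUpTo T := by
  intro s hs h0 hT
  by_contra hre
  have hA : (LFunctions.zetaZeroBox 0 T).Finite := LFunctions.zetaZeroBox_finite 0 T
  have hC : {ρ ∈ LFunctions.zetaZeroBox (1 / 2) T | ρ.re = 1 / 2}.Finite :=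
    (LFunctions.zetaZeroBox_finite _ _).subset (sep_subset _ _)
  have hsA : s ∈ LFunctions.zetaZeroBox 0 T := mem_zetaZeroBox_of_riemannZeta_eq_zero hs h0 hT
  have hsC : s ∉ {ρ ∈ LFunctions.zetaZeroBox (1 / 2) T | ρ.re = 1 / 2} := fun h' ↦ hre h'.2
  have hlt : ∑ᶠ ρ ∈ {ρ ∈ LFunctions.zetaZeroBox (1 / 2) T | ρ.re = 1 / 2}, LFunctions.riemannZetaZeroOrder ρ <
      ∑ᶠ ρ ∈ LFunctions.zetaZeroBox 0 T, LFunctions.riemannZetaZeroOrder ρ := by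
    rw [finsum_mem_eq_finite_toFinset_sum _ hA, finsum_mem_eq_finite_toFinset_sum _ hC]
    refine Finset.sum_lt_sum_of_subset
      ((Finite.toFinset_subset_toFinset).2 (criticalZeroSet_subset_zetaZeroBox T))
      (i := s) ((Finite.mem_toFinset hA).2 hsA) (fun h' ↦ hsC ((Finite.mem_toFinset hC).1 h'))
      (riemannZetaZeroOrder_pos_of_mem_zetaZeroBox hsA) ?_
    intro ρ hρ _
    exact (riemannZetaZeroOrder_pos_of_mem_zetaZeroBox ((Finite.mem_toFinset hA).1 hρ)).le
  have hCnonneg : 0 ≤ ∑ᶠ ρ ∈ {ρ ∈ LFunctions.zetaZeroBox (1 / 2) T | ρ.re = 1 / 2},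
      LFunctions.riemannZetaZeroOrder ρ :=
    finsum_nonneg fun ρ ↦ finsum_nonneg fun hρ ↦
      (riemannZetaZeroOrder_pos_of_mem_zetaZeroBox (criticalZeroSet_subset_zetaZeroBox T hρ)).le
  have hlt' : LFunctions.criticalZeroCount T < LFunctions.zetaZeroCount T := by
    unfold LFunctions.criticalZeroCount LFunctions.zetaZeroCount LFunctions.zetaZeroCountRe
    exact (Int.toNat_lt_toNat (hCnonneg.trans_lt hlt)).2 hlt
  exact lt_irrefl _ (hlt'.trans_le h)

/-- `RiemannHypothesisUpTo T ↔ N₀(T) = N(T)`: RH up to height `T` holds exactly when the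
critical-line zero count exhausts the zero count (both with multiplicity). [folklore] -/
theorem riemannHypothesisUpTo_iff_criticalZeroCount_eq (T : ℝ) :
    RiemannHypothesisUpTo T ↔ LFunctions.criticalZeroCount T = LFunctions.zetaZeroCount T := by
  refine ⟨fun h ↦ ?_, fun h ↦ .of_zetaZeroCount_le_criticalZeroCount h.ge⟩
  unfold LFunctions.criticalZeroCount LFunctions.zetaZeroCount LFunctions.zetaZeroCountRe
  rw [criticalZeroSet_eq_zetaZeroBox_of_riemannHypothesisUpTo h]

/-! ### The Platt–Trudgian computation in count form -/

/-- **Platt–Trudgian 2021, count form.** For `H = 3 000 175 332 800`: the number of zeros of `ζ`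
with `0 < im ρ ≤ H`, counted with multiplicity, is at most `12 363 153 437 138` (Turing's method
at height `H`), and at least that many zeros with `0 < im ρ ≤ H` lie on the critical line
(sign changes of Hardy's `Z`, rigorous ball arithmetic). This is the computational content of
Theorem 1 of the source ("The Riemann hypothesis is true up to height `3 000 175 332 800`. That
is, the lowest `12 363 153 437 138` non-trivial zeroes `ρ` have `Re ρ = 1/2`") as obtained in
its §2; it is stated here in the (weaker) two-inequality form, which by
`criticalZeroCount_le` forces `N₀(H) = N(H) = 12 363 153 437 138`. A 7.5-million-core-hour
computation; no kernel-checkable certificate exists (XL).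
[cite: PlattTrudgianBLMS2021, Theorem 1 and §2] -/
def zetaZeroCount_platt_trudgian : Prop :=
  LFunctions.zetaZeroCount 3000175332800 ≤ 12363153437138 ∧
    12363153437138 ≤ LFunctions.criticalZeroCount 3000175332800

/-- The count form pins down both counts: `N(H) = N₀(H) = 12 363 153 437 138`. [folklore] -/
theorem zetaZeroCount_platt_trudgian.eq (h : zetaZeroCount_platt_trudgian) :
    LFunctions.zetaZeroCount 3000175332800 = 12363153437138 ∧
      LFunctions.criticalZeroCount 3000175332800 = 12363153437138 :=
  ⟨le_antisymm h.1 (h.2.trans (criticalZeroCount_le _)),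
    le_antisymm ((criticalZeroCount_le _).trans h.1) h.2⟩

/-- **Assembly.** The named hypothesis `riemannHypothesisUpTo_platt_trudgian`
(`RiemannHypothesisUpTo 3000175332800`, Platt–Trudgian 2021 Thm. 1) follows from the count form
`zetaZeroCount_platt_trudgian` by the Turing-method reduction. [cite: PlattTrudgianBLMS2021, Theorem 1] -/
theorem riemannHypothesisUpTo_platt_trudgian_of_zeroCount (h : zetaZeroCount_platt_trudgian) :
    riemannHypothesisUpTo_platt_trudgian :=
  RiemannHypothesisUpTo.of_zetaZeroCount_le_criticalZeroCount (h.1.trans h.2)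

end Literature.NumberTheory.DiophantineGeometry

end
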